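import Summits.ResolutionOfSingularities.ResolutionOfSingularities.Theorems.WildQuotientsWildQuotientResolutionToricChartRegular
import Summits.ResolutionOfSingularities.ResolutionOfSingularities.Theorems.FrobeniusLadderFInjectiveMacaulayficationRMonoidDefs
import Summits.ResolutionOfSingularities.ResolutionOfSingularities.Theorems.FrobeniusLadderFInjectiveMacaulayficationSingTowerNesting
import HarnessLib

/-!
# (T-I3b) THE RECURRENT MONOID HABITAT — the seventh Rees chart `D₊(x₂x₄² t)` of `X₁ = Bl_{Sing_red} U_R` is REGULAR, hence FULL at every point
# (crux `FInjectiveMacaulayfication` stmt-ResolutionOfSingularities-15315, chain w45a, door v41.1; res-L1-w45a-plan-1 RULING R23.7 (B-L)(i) ledger; seat res-L1-w45a-lead-1 g12)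

[OURS · L1 W4.5a] Support file (`--supports stmt-ResolutionOfSingularities-15315 --as helper`); replaces the role of NO printed item; NOT a statement of any manuscript;
def-free; UNCONDITIONAL; no named fact. AI-written (AI review is weaker than expert review). Nothing of the crux is proved here.

Of the seven Rees charts of `X₁ = Bl_J U_R` (`RMonoidDefs.rDatum / rJ`, `J = I(Sing_red U_R)`): `l ∈ {0,2,4}` are `≅ U_R` (★ LOOP LEMMA `…RMonoidLoop`), `l ∈ {3,5,6}` are
`𝔸¹ × node` (`…RMonoidNodeCharts`, FULL at closed points `…RMonoidNodeChartsFull`), and — THIS FILE — `l = 1` (`cc_1 = x₂x₄² = wordElem (rJ 1)`, M-exponent `(0,0,0,1)`;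
tri-2's chart_1 «REGULAR») is an AFFINE SPACE chart:
* `isRegularRing_chartRing_one` (binder form) / `…_rDatum` — `IsRegularRing (chartRing (wordElem ∘ rJ) 1)` by the ORIGINAL w45c certificate checker
  ✓`ToricChart.isRegularRing_chartRing_of_check` (one `ChartCert`, `comp-g12/regcert.py`; `check = true` by `decide`);
* `mem_regularLocus_of_isOpenImmersion` (plumbing) and ★ `mem_regularLocus_chart_one`: every point of `D₊(x₂x₄² t) ⊂ X₁` is a regular point of `X₁`;
* ★ `fullCl_stalk_chart_one`: hence `FullCl p 𝒪_{X₁,y}` at EVERY point `y` of that chart, every prime `p` (✓`RegTower.fullCl_stalk_of_mem_regularLocus`, file `…SingTowerNesting`).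
[OURS; folklore toric geometry — cite: CoxLittleSchenck2011, §3.3 (context); StacksProject, Tag 0804; Matsumura1987, Thm. 19.3 (context)]
-/

-- single-problem summit: the doubled namespace component is forced
set_option linter.dupNamespace false

noncomputable section

namespace Summit.ResolutionOfSingularities.ResolutionOfSingularities.Theorems.FInjectiveMacaulayfication.RMonoidRegularChart

open CategoryTheory AlgebraicGeometry Literature.AlgebraicGeometry.Resolution
open Summit.ResolutionOfSingularities.ResolutionOfSingularities.Theorems.FInjectiveMacaulayfication
open Summit.ResolutionOfSingularities.ResolutionOfSingularities.Theorems.WildQuotientResolution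
open Summit.ResolutionOfSingularities.ResolutionOfSingularities.Theorems.WildQuotientResolution.ToricChart

/-- **The chart `D₊(x₂x₄² t)` of `Bl_J U_R` has a REGULAR chart ring** (it is `𝔸⁴ × passengers`; binder form `D = rDatum`, `GJ = rJ`). [OURS] -/
theorem isRegularRing_chartRing_one (k : Type) [Field k] (P : Type) [Finite P]
    (D : ConeDatum 4 4) (hD : D = ⟨![1, 0, 1, 1], ![![0, 1, 1, 1], ![0, 1, 0, 2], ![1, 1, 0, 1], ![1, 1, 1, 0]]⟩)
    (GJ : Fin 7 → Word 4 4) (hGJ : GJ = ![⟨![0, 0, 0, 1], ![0, 0, 0, 0]⟩, ⟨![0, 0, 0, 0], ![0, 1, 0, 0]⟩, ⟨![0, 0, 0, 0], ![1, 0, 0, 0]⟩, ⟨![1, 0, 1, 0], ![0, 0, 0, 0]⟩, ⟨![0, 0, 0, 0], ![0, 0, 1, 0]⟩, ⟨![0, 0, 1, 0], ![0, 0, 0, 1]⟩, ⟨![1, 0, 0, 0], ![0, 0, 0, 1]⟩]) :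
    IsRegularRing (chartRing (fun l : Fin 7 => wordElem k P D (GJ l)) 1) :=
  isRegularRing_chartRing_of_check k P D GJ 1
    ⟨![1, 0, 1, 1], ![![1, 0, 0, 0, 0, 0, 0], ![0, 0, 0, 0, 0, 0, 0], ![0, 0, 1, 0, 0, 0, 0], ![0, 0, 0, 0, 1, 0, 0]], ![⟨![0, 0, 0, 0], ![0, 0, 0, 0]⟩, ⟨![0, 0, 0, 0], ![0, 1, 0, 0]⟩, ⟨![0, 0, 0, 0], ![0, 0, 0, 0]⟩, ⟨![0, 0, 0, 0], ![0, 0, 0, 0]⟩], ![![1, 1, 0, 1], ![0, 0, 0, 0], ![1, 1, 1, 0], ![1, 1, 0, 0]], ![![0, 1, 1, 0], ![0, 1, 0, 0], ![0, 1, 0, 1], ![0, 1, 1, 1]], ![![1, 0, 0, 0], ![0, 0, 0, 0], ![0, 0, 1, 0], ![2, 1, 1, 1], ![0, 0, 0, 1], ![1, 1, 2, 1], ![1, 1, 1, 2]], -1, ![![-1, -1, 0, -1], ![2, 1, 0, 0], ![-1, -1, -1, 0], ![-1, -1, 0, 0]]⟩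
    (by subst hD hGJ; decide)

/-- The same on the named bed `RMonoidDefs.rDatum / rJ`. [OURS] -/
theorem isRegularRing_chartRing_one_rDatum (k : Type) [Field k] (P : Type) [Finite P] :
    IsRegularRing (chartRing (fun l : Fin 7 => wordElem k P RMonoidDefs.rDatum (RMonoidDefs.rJ l)) 1) :=
  isRegularRing_chartRing_one k P _ rfl _ rfl

/-- Open immersions preserve regular points. [plumbing; cite: StacksProject, Tag 01J5] -/
theorem mem_regularLocus_of_isOpenImmersion {X Y : Scheme.{0}} (f : X ⟶ Y) [IsOpenImmersion f] (x : X) (hx : x ∈ Scheme.regularLocus X) :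
    f.base x ∈ Scheme.regularLocus Y := by
  rw [Scheme.mem_regularLocus] at hx ⊢
  exact IsRegularLocalRing.of_ringEquiv (asIso (f.stalkMap x)).commRingCatIsoToRingEquiv.symm

/-- ★ **Every point of the chart `D₊(x₂x₄² t)` of `X₁ = Bl_J U_R` is a regular point of `X₁`** (`RMonoidDefs.rDatum / rJ`, no passengers). [OURS · assembly] -/
theorem mem_regularLocus_chart_one (k : Type) [Field k] (y : ↥(affineBlowup (Ideal.span (Set.range fun l : Fin 7 => wordElem k PEmpty RMonoidDefs.rDatum (RMonoidDefs.rJ l)))))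
    (hy : y ∈ Proj.basicOpen (reesGrading (Ideal.span (Set.range fun l : Fin 7 => wordElem k PEmpty RMonoidDefs.rDatum (RMonoidDefs.rJ l)))) (reesT (wordElem k PEmpty RMonoidDefs.rDatum (RMonoidDefs.rJ 1))
      (Ideal.mem_span_range_self (f := fun l : Fin 7 => wordElem k PEmpty RMonoidDefs.rDatum (RMonoidDefs.rJ l)) (x := 1)))) :
    y ∈ Scheme.regularLocus (affineBlowup (Ideal.span (Set.range fun l : Fin 7 => wordElem k PEmpty RMonoidDefs.rDatum (RMonoidDefs.rJ l)))) := by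
  haveI : IsRegularRing (CommRingCat.of (chartRing (fun l : Fin 7 => wordElem k PEmpty RMonoidDefs.rDatum (RMonoidDefs.rJ l)) 1)) :=
    isRegularRing_chartRing_one_rDatum k PEmpty
  let ι := Proj.awayι (reesGrading (Ideal.span (Set.range fun l : Fin 7 => wordElem k PEmpty RMonoidDefs.rDatum (RMonoidDefs.rJ l)))) (reesT (wordElem k PEmpty RMonoidDefs.rDatum (RMonoidDefs.rJ 1))
      (Ideal.mem_span_range_self (f := fun l : Fin 7 => wordElem k PEmpty RMonoidDefs.rDatum (RMonoidDefs.rJ l)) (x := 1)))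
    (reesT_mem _ _) Nat.one_pos
  have hy' : y ∈ (ι.opensRange : Set _) := by rw [Proj.opensRange_awayι]; exact hy
  obtain ⟨q, rfl⟩ := hy'
  refine mem_regularLocus_of_isOpenImmersion ι q ?_
  rw [(Scheme.isRegular_Spec _).regularLocus_eq_univ]
  trivial

/-- ★ **The chart `D₊(x₂x₄² t)` of `X₁ = Bl_J U_R` is FULL at EVERY point, every prime `p`** (`k` of characteristic `p`). [OURS · assembly] -/
theorem fullCl_stalk_chart_one (p : ℕ) [Fact p.Prime] (k : Type) [Field k] [CharP k p] (y : ↥(affineBlowup (Ideal.span (Set.range fun l : Fin 7 => wordElem k PEmpty RMonoidDefs.rDatum (RMonoidDefs.rJ l)))))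
    (hy : y ∈ Proj.basicOpen (reesGrading (Ideal.span (Set.range fun l : Fin 7 => wordElem k PEmpty RMonoidDefs.rDatum (RMonoidDefs.rJ l)))) (reesT (wordElem k PEmpty RMonoidDefs.rDatum (RMonoidDefs.rJ 1))
      (Ideal.mem_span_range_self (f := fun l : Fin 7 => wordElem k PEmpty RMonoidDefs.rDatum (RMonoidDefs.rJ l)) (x := 1)))) :
    SliceableCentre.FullCl p ((affineBlowup (Ideal.span (Set.range fun l : Fin 7 => wordElem k PEmpty RMonoidDefs.rDatum (RMonoidDefs.rJ l)))).presheaf.stalk y) :=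
  RegTower.fullCl_stalk_of_mem_regularLocus p
    (affineBlowup.π (Ideal.span (Set.range fun l : Fin 7 => wordElem k PEmpty RMonoidDefs.rDatum (RMonoidDefs.rJ l))) ≫ Spec.map (CommRingCat.ofHom (algebraMap k (Ring k PEmpty RMonoidDefs.rDatum)))) y
    (mem_regularLocus_chart_one k y hy)

end Summit.ResolutionOfSingularities.ResolutionOfSingularities.Theorems.FInjectiveMacaulayfication.RMonoidRegularChart

end
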